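import Summits.CriticalPhenomena.CardyFormulaZ2.Theorems.CardyComplexConeParafermionToSLESixFamiliesDiamondPotentialConformalLimit
import Summits.CriticalPhenomena.CardyFormulaZ2.Theorems.CardyComplexConeParafermionToSLESixFamiliesDiamondDefsR5
import Summits.CriticalPhenomena.CardyFormulaZ2.Theorems.CardyComplexConeParafermionToSLESixFamiliesIicRectilinear
import Summits.CriticalPhenomena.CardyFormulaZ2.Theorems.CardyComplexConeParafermionToSLESixFamiliesFlipAllDomainsOfDiag
import Summits.CriticalPhenomena.CardyFormulaZ2.Theorems.CardyComplexConeParafermionToSLESixFamiliesFlipDiagArmLowerOfIkhlefPonsaing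
import Summits.CriticalPhenomena.CardyFormulaZ2.Theorems.CardyComplexConeDefs
import HarnessLib

/-!
# Bridge certificate for the r1 decomposition of crux `ParafermionToSLESixFamilies` (stmt-CriticalPhenomena-11389)

The five children of `Sketch.lean` are restated VERBATIM (route-file vocabulary) inside the route namespace and tied,
kernel-checked, to the tree's vocabulary and to the landed reductions — so that every OPEN child carries its PLAN as a
sorry-free implication from NAMED registered stubs / named Literature facts:

* child 1 `DiagBoundaryArmLower` ↔ `FlipInvolutionReturnLaw.DiagHalfPlaneOneArmLower` (`Iff.rfl`); conditionally PROVED from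
  `Literature.Probability.Percolation.IkhlefPonsaingFirstPassage` (`diagArmLower_of_ikhlefPonsaing`, p119507).
* child 2 `CoherentEnvelope` ↔ `QkzStripBoundaryArm.UniformInnerEnvelope ∧ EdgeCoherence ∧ EdgePrecompact` (`Iff.rfl`).
* the inline "SLE₆ on all-diagonal polygons" block ↔ `∀ D, IsDiagRectilinear D → ∀ Λ, IsFamily D Λ → SLESixAlong D Λ`
  (the hypothesis of the lead's S7 / flip's `stub_allDomainsOfDiag`).
* child 3 `SharpInputsGiveDiagSLESix` ⇐ the lead's five remaining registered stubs of line `potential-darboux-picard-diamond`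
  (wave-5 conditionals `collar_of_uniformInnerEnvelope`, `closedClass_of_edgeCoherence_edgePrecompact`,
  `freeTouchLower_of_diagArmLower`; S5 `stub_pinUniformity`; S6 `stub_identOnDiagRectilinear`) through the LANDED
  `closedPrecompactness_of_parts`, `potentialConformalLimit_of_closedPrecompactness` (S1+S2+S4′) and `slesixAlong_of_ident`.
* child 4 `DiagSLESixGivesCardy` ⇐ PIECE 1 of `allDomainsOfDiag_of` through the PROVED `cardyFormulaZ2_of_diagCardy` (PIECE 2).
* child 5 `CardyLiftsToSLESix` ⇐ PIECE 3 (Camia–Newman on ℤ²) through the landed `slesixAllFamilies_of_identAllFamilies`.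
-/

noncomputable section

namespace Summit.CriticalPhenomena.CardyFormulaZ2.Theses.CardyComplexCone

open scoped BigOperators Topology Classical MeasureTheory ProbabilityTheory
open Filter Set MeasureTheory
open Literature.Probability Literature.Probability.LatticeModels Literature.Probability.Percolation
open Literature.Probability.RandomPlanarGeometry
open Summit.CriticalPhenomena.CardyFormulaZ2.Cruxes.ParafermionToSLESixFamilies.IicTraceFluxPairing
  (IsFamily iface perc SLESixAlong SLESixAllFamilies slesixAllFamilies_iff slesixAlong_of_ident slesixAllFamilies_of_identAllFamilies)
open Summit.CriticalPhenomena.CardyFormulaZ2.Cruxes.ParafermionToSLESixFamilies.FlipInvolutionReturnLaw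
  (IsDiagRectilinear IdentOnDiagRectilinear DiagHalfPlaneOneArmLower diagArmLower_of_ikhlefPonsaing cardyFormulaZ2_of_diagCardy allDomainsOfDiag_of)
open Summit.CriticalPhenomena.CardyFormulaZ2.Cruxes.ParafermionToSLESixFamilies.PotentialDarbouxPicardDiamond
  (ClosedPrecompactness PotentialConformalLimit DiagTouchLawPosPin ClosedCollar ClosedClass FreeTouchLower
   closedPrecompactness_of_parts potentialConformalLimit_of_closedPrecompactness)
open Summit.CriticalPhenomena.CardyFormulaZ2.Cruxes.EdgePrecompact.QkzStripBoundaryArm (UniformInnerEnvelope)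

/-! ## The five children, verbatim as in `Sketch.lean` -/

def DiagBoundaryArmLower : Prop :=
  ∃ c : ℝ, 0 < c ∧ ∀ᶠ n : ℕ in Filter.atTop, c * (n : ℝ) ^ (-((1:ℝ) / 3)) ≤ (Literature.Probability.Percolation.bondPercolation (Literature.Probability.LatticeModels.zdGraph 2) Literature.Probability.Percolation.half).real {ω | ∃ y : Literature.Probability.LatticeModels.Site 2, (y 0 + y 1 = -(n : ℤ) ∨ y 0 - y 1 = (n : ℤ) ∨ y 0 - y 1 = -(n : ℤ)) ∧ ω ∈ Literature.Probability.Percolation.openConnIn {v : Literature.Probability.LatticeModels.Site 2 | v 0 + v 1 ≤ 1 ∧ -(n : ℤ) ≤ v 0 + v 1 ∧ -(n : ℤ) ≤ v 0 - v 1 ∧ v 0 - v 1 ≤ n} 0 y}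

def CoherentEnvelope : Prop :=
  (∃ C : ℝ, ∀ (D : Literature.Probability.RandomPlanarGeometry.DobrushinDomain) (E : Literature.Probability.LatticeModels.DiscreteDobrushin), E.Ω = D.carrier → E.IsZdAdmissible → ∀ v f : Literature.Probability.LatticeModels.Site 2, Literature.Probability.LatticeModels.IsCorner v f → ∀ R : ℕ, 1 ≤ R → (R : ℝ) * E.δ ≤ Metric.infDist (Literature.Probability.LatticeModels.meshPoint E.δ v) D.carrierᶜ → ‖(∫ ω, (let γ := Literature.Probability.LatticeModels.medialExploration E ω; ∑ k ∈ (Finset.range γ.length).filter (fun k => γ[k]? = some (Literature.Probability.LatticeModels.cornerSource v f) ∧ γ[k + 1]? = some (Literature.Probability.LatticeModels.cornerTarget v f)), Complex.exp (-(Complex.I / 3) * ((Literature.Probability.LatticeModels.Polyline.winding ((γ.map (Literature.Probability.LatticeModels.medialPoint E.δ)).take (k + 2)) : ℝ) : ℂ))) ∂(Literature.Probability.Percolation.bondPercolation (Literature.Probability.LatticeModels.zdGraph 2) Literature.Probability.Percolation.half))‖ ≤ C * (R : ℝ) ^ (-(1:ℝ) / 3)) ∧ EdgeCoherence ∧ 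EdgePrecompact

def SharpInputsGiveDiagSLESix : Prop :=
  DiagBoundaryArmLower → CoherentEnvelope → (∀ (D : Literature.Probability.RandomPlanarGeometry.DobrushinDomain) (Λ : ℝ → Literature.Probability.LatticeModels.DiscreteDobrushin), (∃ S : Finset (ℂ × ℂ), (∀ e ∈ S, (e.1 - e.2).re = (e.1 - e.2).im ∨ (e.1 - e.2).re = -(e.1 - e.2).im) ∧ frontier D.carrier = ⋃ e ∈ S, segment ℝ e.1 e.2) → (∀ δ, (Λ δ).Ω = D.carrier) → (∀ δ, (Λ δ).δ = δ) → Tendsto (fun δ : ℝ => Metric.hausdorffEDist (Λ δ).arcA (D.arc 0)) (𝓝[>] (0:ℝ)) (𝓝 0) → Tendsto (fun δ : ℝ => Metric.hausdorffEDist (Λ δ).arcB (D.arc 1)) (𝓝[>] (0:ℝ)) (𝓝 0) → Tendsto (fun δ : ℝ => Metric.hausdorffEDist (Literature.Probability.LatticeModels.medialPoint δ '' (Λ δ).zdABEdges) {D.pt 0, D.pt 1}) (𝓝[>] (0:ℝ)) (𝓝 0) → (∀ᶠ δ in 𝓝[>] (0:ℝ), (Λ δ).IsZdAdmissible) → Literature.Probability.RandomPlanarGeometry.ConvergesInLawToSLE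 6 D (Ωδ := fun _ => Literature.Probability.Percolation.BondConfig (Literature.Probability.LatticeModels.Site 2)) (fun δ ω => Literature.Probability.RandomPlanarGeometry.CurveClass.mk (if dist (Literature.Probability.LatticeModels.medialExplorationCurve (Λ δ) ω 0) (D.pt 0) ≤ dist (Literature.Probability.LatticeModels.medialExplorationCurve (Λ δ) ω 0) (D.pt 1) then (⟨Literature.Probability.LatticeModels.medialExplorationCurve (Λ δ) ω⟩ : Literature.Probability.RandomPlanarGeometry.Curve ℂ) else ⟨(Literature.Probability.LatticeModels.medialExplorationCurve (Λ δ) ω).comp ⟨unitInterval.symm, unitInterval.continuous_symm⟩⟩)) (fun _ => Literature.Probability.Percolation.bondPercolation (Literature.Probability.LatticeModels.zdGraph 2) Literature.Probability.Percolation.half))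

def DiagSLESixGivesCardy : Prop :=
  (∀ (D : Literature.Probability.RandomPlanarGeometry.DobrushinDomain) (Λ : ℝ → Literature.Probability.LatticeModels.DiscreteDobrushin), (∃ S : Finset (ℂ × ℂ), (∀ e ∈ S, (e.1 - e.2).re = (e.1 - e.2).im ∨ (e.1 - e.2).re = -(e.1 - e.2).im) ∧ frontier D.carrier = ⋃ e ∈ S, segment ℝ e.1 e.2) → (∀ δ, (Λ δ).Ω = D.carrier) → (∀ δ, (Λ δ).δ = δ) → Tendsto (fun δ : ℝ => Metric.hausdorffEDist (Λ δ).arcA (D.arc 0)) (𝓝[>] (0:ℝ)) (𝓝 0) → Tendsto (fun δ : ℝ => Metric.hausdorffEDist (Λ δ).arcB (D.arc 1)) (𝓝[>] (0:ℝ)) (𝓝 0) → Tendsto (fun δ : ℝ => Metric.hausdorffEDist (Literature.Probability.LatticeModels.medialPoint δ '' (Λ δ).zdABEdges) {D.pt 0, D.pt 1}) (𝓝[>] (0:ℝ)) (𝓝 0) → (∀ᶠ δ in 𝓝[>] (0:ℝ), (Λ δ).IsZdAdmissible) → Literature.Probability.RandomPlanarGeometry.ConvergesInLawToSLE 6 D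 (Ωδ := fun _ => Literature.Probability.Percolation.BondConfig (Literature.Probability.LatticeModels.Site 2)) (fun δ ω => Literature.Probability.RandomPlanarGeometry.CurveClass.mk (if dist (Literature.Probability.LatticeModels.medialExplorationCurve (Λ δ) ω 0) (D.pt 0) ≤ dist (Literature.Probability.LatticeModels.medialExplorationCurve (Λ δ) ω 0) (D.pt 1) then (⟨Literature.Probability.LatticeModels.medialExplorationCurve (Λ δ) ω⟩ : Literature.Probability.RandomPlanarGeometry.Curve ℂ) else ⟨(Literature.Probability.LatticeModels.medialExplorationCurve (Λ δ) ω).comp ⟨unitInterval.symm, unitInterval.continuous_symm⟩⟩)) (fun _ => Literature.Probability.Percolation.bondPercolation (Literature.Probability.LatticeModels.zdGraph 2) Literature.Probability.Percolation.half)) → _root_.CardyFormulaZ2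

def CardyLiftsToSLESix : Prop :=
  _root_.CardyFormulaZ2 → (∀ (D : Literature.Probability.RandomPlanarGeometry.DobrushinDomain) (Λ : ℝ → Literature.Probability.LatticeModels.DiscreteDobrushin), (∀ δ, (Λ δ).Ω = D.carrier) → (∀ δ, (Λ δ).δ = δ) → Tendsto (fun δ : ℝ => Metric.hausdorffEDist (Λ δ).arcA (D.arc 0)) (𝓝[>] (0:ℝ)) (𝓝 0) → Tendsto (fun δ : ℝ => Metric.hausdorffEDist (Λ δ).arcB (D.arc 1)) (𝓝[>] (0:ℝ)) (𝓝 0) → Tendsto (fun δ : ℝ => Metric.hausdorffEDist (Literature.Probability.LatticeModels.medialPoint δ '' (Λ δ).zdABEdges) {D.pt 0, D.pt 1}) (𝓝[>] (0:ℝ)) (𝓝 0) → (∀ᶠ δ in 𝓝[>] (0:ℝ), (Λ δ).IsZdAdmissible) → Literature.Probability.RandomPlanarGeometry.ConvergesInLawToSLE 6 D (Ωδ := fun _ => Literature.Probability.Percolation.BondConfig (Literature.Probability.LatticeModels.Site 2)) (fun δ ω => Literature.Probability.RandomPlanarGeometry.CurveClass.mk (if dist (Literature.Probability.LatticeModels.medialExplorationCurve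 (Λ δ) ω 0) (D.pt 0) ≤ dist (Literature.Probability.LatticeModels.medialExplorationCurve (Λ δ) ω 0) (D.pt 1) then (⟨Literature.Probability.LatticeModels.medialExplorationCurve (Λ δ) ω⟩ : Literature.Probability.RandomPlanarGeometry.Curve ℂ) else ⟨(Literature.Probability.LatticeModels.medialExplorationCurve (Λ δ) ω).comp ⟨unitInterval.symm, unitInterval.continuous_symm⟩⟩)) (fun _ => Literature.Probability.Percolation.bondPercolation (Literature.Probability.LatticeModels.zdGraph 2) Literature.Probability.Percolation.half))

theorem ParafermionToSLESixFamilies_of_subs :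
    DiagBoundaryArmLower → CoherentEnvelope → SharpInputsGiveDiagSLESix → DiagSLESixGivesCardy → CardyLiftsToSLESix →
      ParafermionToSLESixFamilies :=
  fun h₁ h₂ h₃ h₄ h₅ _ _ => h₅ (h₄ (h₃ h₁ h₂))

/-! ## Identities with the tree's vocabulary -/

theorem diagBoundaryArmLower_iff : DiagBoundaryArmLower ↔ DiagHalfPlaneOneArmLower := Iff.rfl

theorem coherentEnvelope_iff : CoherentEnvelope ↔ (UniformInnerEnvelope ∧ EdgeCoherence ∧ EdgePrecompact) := by
  unfold CoherentEnvelope UniformInnerEnvelope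
    Summit.CriticalPhenomena.CardyFormulaZ2.Cruxes.EdgePrecompact.QkzStripBoundaryArm.cornerObs
  exact Iff.rfl

/-- The inline block of children 3/4 is block C of the crux restricted to all-diagonal polygons, i.e. the hypothesis of
the lead's S7 `stub_allDomainsOfDiagRectilinear` (= flip's `stub_allDomainsOfDiag`). -/
theorem diagSLESix_iff :
    (∀ (D : Literature.Probability.RandomPlanarGeometry.DobrushinDomain) (Λ : ℝ → Literature.Probability.LatticeModels.DiscreteDobrushin), (∃ S : Finset (ℂ × ℂ), (∀ e ∈ S, (e.1 - e.2).re = (e.1 - e.2).im ∨ (e.1 - e.2).re = -(e.1 - e.2).im) ∧ frontier D.carrier = ⋃ e ∈ S, segment ℝ e.1 e.2) → (∀ δ, (Λ δ).Ω = D.carrier) → (∀ δ, (Λ δ).δ = δ) → Tendsto (fun δ : ℝ => Metric.hausdorffEDist (Λ δ).arcA (D.arc 0)) (𝓝[>] (0:ℝ)) (𝓝 0) → Tendsto (fun δ : ℝ => Metric.hausdorffEDist (Λ δ).arcB (D.arc 1)) (𝓝[>] (0:ℝ)) (𝓝 0) → Tendsto (fun δ : ℝ => Metric.hausdorffEDist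 (Literature.Probability.LatticeModels.medialPoint δ '' (Λ δ).zdABEdges) {D.pt 0, D.pt 1}) (𝓝[>] (0:ℝ)) (𝓝 0) → (∀ᶠ δ in 𝓝[>] (0:ℝ), (Λ δ).IsZdAdmissible) → Literature.Probability.RandomPlanarGeometry.ConvergesInLawToSLE 6 D (Ωδ := fun _ => Literature.Probability.Percolation.BondConfig (Literature.Probability.LatticeModels.Site 2)) (fun δ ω => Literature.Probability.RandomPlanarGeometry.CurveClass.mk (if dist (Literature.Probability.LatticeModels.medialExplorationCurve (Λ δ) ω 0) (D.pt 0) ≤ dist (Literature.Probability.LatticeModels.medialExplorationCurve (Λ δ) ω 0) (D.pt 1) then (⟨Literature.Probability.LatticeModels.medialExplorationCurve (Λ δ) ω⟩ : Literature.Probability.RandomPlanarGeometry.Curve ℂ) else ⟨(Literature.Probability.LatticeModels.medialExplorationCurve (Λ δ) ω).comp ⟨unitInterval.symm, unitInterval.continuous_symm⟩⟩)) (fun _ => Literature.Probability.Percolation.bondPercolation (Literature.Probability.LatticeModels.zdGraph 2) Literature.Probability.Percolation.half)) ↔ (∀ D : DobrushinDomain, IsDiagRectilinear D → ∀ Λ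 : ℝ → DiscreteDobrushin, IsFamily D Λ → SLESixAlong D Λ) := by
  constructor
  · intro h D hD Λ hΛ
    exact h D Λ hD hΛ.1 hΛ.2.1 hΛ.2.2.1 hΛ.2.2.2.1 hΛ.2.2.2.2.1 hΛ.2.2.2.2.2
  · intro h D Λ hD h1 h2 h3 h4 h5 h6
    exact h D hD Λ ⟨h1, h2, h3, h4, h5, h6⟩

/-- Block C inline (child 5's conclusion) is the tree's `SLESixAllFamilies`. -/
theorem blockC_iff : (∀ (D : Literature.Probability.RandomPlanarGeometry.DobrushinDomain) (Λ : ℝ → Literature.Probability.LatticeModels.DiscreteDobrushin), (∀ δ, (Λ δ).Ω = D.carrier) → (∀ δ, (Λ δ).δ = δ) → Tendsto (fun δ : ℝ => Metric.hausdorffEDist (Λ δ).arcA (D.arc 0)) (𝓝[>] (0:ℝ)) (𝓝 0) → Tendsto (fun δ : ℝ => Metric.hausdorffEDist (Λ δ).arcB (D.arc 1)) (𝓝[>] (0:ℝ)) (𝓝 0) → Tendsto (fun δ : ℝ => Metric.hausdorffEDist (Literature.Probability.LatticeModels.medialPoint δ '' (Λ δ).zdABEdges) {D.pt 0, D.pt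 1}) (𝓝[>] (0:ℝ)) (𝓝 0) → (∀ᶠ δ in 𝓝[>] (0:ℝ), (Λ δ).IsZdAdmissible) → Literature.Probability.RandomPlanarGeometry.ConvergesInLawToSLE 6 D (Ωδ := fun _ => Literature.Probability.Percolation.BondConfig (Literature.Probability.LatticeModels.Site 2)) (fun δ ω => Literature.Probability.RandomPlanarGeometry.CurveClass.mk (if dist (Literature.Probability.LatticeModels.medialExplorationCurve (Λ δ) ω 0) (D.pt 0) ≤ dist (Literature.Probability.LatticeModels.medialExplorationCurve (Λ δ) ω 0) (D.pt 1) then (⟨Literature.Probability.LatticeModels.medialExplorationCurve (Λ δ) ω⟩ : Literature.Probability.RandomPlanarGeometry.Curve ℂ) else ⟨(Literature.Probability.LatticeModels.medialExplorationCurve (Λ δ) ω).comp ⟨unitInterval.symm, unitInterval.continuous_symm⟩⟩)) (fun _ => Literature.Probability.Percolation.bondPercolation (Literature.Probability.LatticeModels.zdGraph 2) Literature.Probability.Percolation.half)) ↔ SLESixAllFamilies := Iff.rfl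

/-! ## Plans of the open children as kernel-checked reductions to named stubs / facts -/

/-- child 1: CONDITIONALLY PROVED from the named Literature fact (p119507). -/
theorem diagBoundaryArmLower_of_ikhlefPonsaing (h : Literature.Probability.Percolation.IkhlefPonsaingFirstPassage) :
    DiagBoundaryArmLower :=
  diagArmLower_of_ikhlefPonsaing h

/-- child 2: closes from 11387's milestone and the route's rank-2/3 cruxes. -/
theorem coherentEnvelope_of (hU : UniformInnerEnvelope) (hC : EdgeCoherence) (hP : EdgePrecompact) : CoherentEnvelope :=
  coherentEnvelope_iff.2 ⟨hU, hC, hP⟩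

/-- child 2 projects to the route's target. -/
theorem target_of_coherentEnvelope (h : CoherentEnvelope) : Target := ⟨h.2.1, h.2.2⟩

/-- child 3's PLAN = the live line `potential-darboux-picard-diamond` cut at the curve law on diagonal polygons: its five
remaining registered stubs (the three wave-5 conditionals for S3, S5, S6) imply child 3 through the landed S1/S2/S4′
(`potentialConformalLimit_of_closedPrecompactness`), `closedPrecompactness_of_parts` and `slesixAlong_of_ident`. -/
theorem sharpInputsGiveDiagSLESix_of_diamond
    (c₁ : UniformInnerEnvelope → ClosedCollar)
    (c₂ : EdgeCoherence → EdgePrecompact → ClosedClass)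
    (c₃ : DiagHalfPlaneOneArmLower → FreeTouchLower)
    (s₅ : PotentialConformalLimit → ∀ D : DobrushinDomain, IsDiagRectilinear D → DiagTouchLawPosPin D)
    (s₆ : (∀ D : DobrushinDomain, IsDiagRectilinear D → DiagTouchLawPosPin D) → IdentOnDiagRectilinear) :
    SharpInputsGiveDiagSLESix := by
  intro hN hCE
  have hX := coherentEnvelope_iff.1 hCE
  have h3 : ClosedPrecompactness := closedPrecompactness_of_parts (c₁ hX.1) (c₂ hX.2.1 hX.2.2) (c₃ hN)
  have hI : IdentOnDiagRectilinear := s₆ (s₅ (potentialConformalLimit_of_closedPrecompactness h3))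
  exact diagSLESix_iff.2 fun D hD Λ hΛ => slesixAlong_of_ident D Λ hΛ (hI D hD Λ hΛ)

/-- child 4's PLAN = PIECE 1 of `allDomainsOfDiag_of` (crux 9654's collar-touch-sandwich run at all-diagonal designer domains)
followed by the PROVED diagonal Bollobás–Riordan sandwich (PIECE 2, `cardyFormulaZ2_of_diagCardy`). -/
theorem diagSLESixGivesCardy_of_piece1
    (h₁ : (∀ D : DobrushinDomain, IsDiagRectilinear D → ∀ Λ : ℝ → DiscreteDobrushin, IsFamily D Λ → SLESixAlong D Λ) →
      ∀ R : ConformalRectangle, (∃ S : Finset (ℂ × ℂ), (∀ p ∈ S, (p.1 - p.2).re = (p.1 - p.2).im ∨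
        (p.1 - p.2).re = -(p.1 - p.2).im) ∧ frontier R.carrier ⊆ ⋃ p ∈ S, segment ℝ p.1 p.2) →
        R.HasCrossingLimit (bondDomainCrossingProb R) Literature.Probability.RandomPlanarGeometry.cardyFunction) :
    DiagSLESixGivesCardy :=
  fun h => cardyFormulaZ2_of_diagCardy (h₁ (diagSLESix_iff.1 h))

/-- child 5's PLAN = PIECE 3 (Camia–Newman identification on ℤ² from Cardy) + the landed `slesixAllFamilies_of_identAllFamilies`. -/
theorem cardyLiftsToSLESix_of_piece3
    (h₃ : Literature.Probability.Percolation.CardyFormulaZ2 → ∀ (D : DobrushinDomain) (Λ : ℝ → DiscreteDobrushin),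
      IsFamily D Λ → ∀ μ : Measure (CurveClass ℂ), IsProbabilityMeasure μ → IsSubseqLimitLaw (iface D Λ) perc μ →
        IsSLELaw 6 D μ) :
    CardyLiftsToSLESix :=
  fun hS => blockC_iff.2 (slesixAllFamilies_of_identAllFamilies (h₃ hS))

/-- Consistency with the lead's skeleton: children 3 + 4 + 5 reproduce S7's landed reduction `allDomainsOfDiag_of`
(PIECE 1, PIECE 3 ⊢ diagonal SLE₆ → block C). -/
theorem s7_of_children (h₄ : DiagSLESixGivesCardy) (h₅ : CardyLiftsToSLESix) :
    (∀ D : DobrushinDomain, IsDiagRectilinear D → ∀ Λ : ℝ → DiscreteDobrushin, IsFamily D Λ → SLESixAlong D Λ) →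
      SLESixAllFamilies :=
  fun h => blockC_iff.1 (h₅ (h₄ (diagSLESix_iff.2 h)))

/-- THE SUMMIT CUT (what a tenure planner may re-wire `closes` through): children 1–4 decide the sub-problem. -/
theorem cardyFormulaZ2_of_children (h₁ : DiagBoundaryArmLower) (h₂ : CoherentEnvelope) (h₃ : SharpInputsGiveDiagSLESix)
    (h₄ : DiagSLESixGivesCardy) : _root_.CardyFormulaZ2 :=
  h₄ (h₃ h₁ h₂)

end Summit.CriticalPhenomena.CardyFormulaZ2.Theses.CardyComplexCone

end
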